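import Literature.Analysis.FluidPDE.AxisymNoSwirlScaleInvariantBounds
import Literature.Analysis.FluidPDE.ClassicalNSPairingIdentity
import Literature.Analysis.FluidPDE.VorticityCalculus
import Literature.Analysis.FluidPDE.VectorCalculusProofs
import HarnessLib

/-!
# Gallay–Šverák 2015, Lemma 6.4 (conservation of the impulse) is a THEOREM — discharge of the
# named fact `GallaySverak2015.ImpulseConservation`

Analysis/FluidPDE proof file (theorems only: no definitions, no named facts, no `sorry`). It proves
the Literature fact `Literature.Analysis.FluidPDE.GallaySverak2015.ImpulseConservation`
(`AxisymNoSwirlScaleInvariantBounds.lean`; Th. Gallay, V. Šverák, *Remarks on the Cauchy problem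
for the axisymmetric Navier–Stokes equations*, Confluentes Math. 7 (2015) 67–92 =
arXiv:1510.01036, **Lemma 6.4**, arXiv p. 19: "For any non-negative solution of (4.1) in `L¹(Ω)`
with finite impulse, we have `∫_Ω r²ω_θ(r,z,t) dr dz = ∫_Ω r²ω₀(r,z) dr dz`, `t ≥ 0`"), in the
tree's rendering for Tao's smooth finite-energy class: along a Tao-class solution
`IsTaoSolutionOn T 1 u₀ u p` from an axisymmetric swirl-free datum with `η₀ = ω_θ/r ≥ 0`,
`η₀ ∈ L¹(ℝ³)`, `r²η₀ ∈ L¹(ℝ³)`, every slice `r²η(t)` is integrable and `∫ r²η(t) dx = ∫ r²η₀ dx`.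
Together with `GallaySverak2015.VelocitySupBound` (Prop. 2.6 (2.14)) this is one of the two
hypotheses of the all-time speed cap `speedCap_of_facts` of that file (cell `pub/ns-blowup`,
ladder N1, binder `HeredityAtOne`). WHAT THIS IS NOT: not a statement about Navier–Stokes blow-up
or regularity — a conservation law for smooth finite-energy swirl-free axisymmetric flows.

## The proof (3-D impulse route)

The weighted vorticity moment `∫ r²η dx` is the axial component of the hydrodynamic impulse
`∫ (x × ω)_z dx = ∫ ⟪curl u, J⟫ dx`, `Jx = (−x₁, x₀, 0)` (`curl u = η J`, `|Jx|² = r²`). With the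
tree's cut-off `χ_R = cutoff R` and the compactly supported, divergence-free test field
`ψ_R := curl (χ_R J)`:

* `∫ χ_R r²η(t) dx = ∫ ⟪curl u(t), χ_R J⟫ = ∫ ⟪u(t), ψ_R⟫` (integration by parts for the curl,
  `integral_inner_curl_eq_integral_inner_curl`);
* `ψ_R(x) = ψ_1(x/R)` (scaling), so `‖Dψ_R‖ ≤ B₁/R`, `‖Δψ_R‖ ≤ B₂/R²`, and `ψ_R`, `Δψ_R` vanish
  off the ball of radius `2R` (volume `8R³ |B(0,1)|`);
* the classical momentum equation tested against `ψ_R`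
  (`IsClassicalNSSolutionOn.integral_inner_sub_eq_pressure`: the pressure pairs with
  `div ψ_R = div curl = 0`, the force is `0`) gives
  `∫ ⟪u(t), ψ_R⟫ − ∫ ⟪u(0), ψ_R⟫ = ∫₀ᵗ ∫ (⟪u, (u·∇)ψ_R⟫ + ν⟪u, Δψ_R⟫)`, and the slice estimate
  `|∫ (⟪v, (v·∇)ψ_R⟫ + ν⟪v, Δψ_R⟫)| ≤ K/√R` for `∫‖v‖² ≤ E` (pointwise
  `‖v‖𝟙_B ≤ (λ𝟙_B + λ⁻¹‖v‖²)/2`, `λ = (R√R)⁻¹`) — only the ENERGY of the solution enters;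
* `∫ χ_R r²η₀ → ∫ r²η₀` (dominated convergence, `tendsto_integral_cutoff_mul`), hence
  `∫ χ_R r²η(t) → ∫ r²η₀`; since `η(t) ≥ 0` (maximum principle / sign persistence for `ω_θ/r`,
  `IsTaoSolutionOn.angVortQuot_nonneg_of_datum`), Fatou's lemma gives `r²η(t) ∈ L¹`, and dominated
  convergence identifies `∫ r²η(t)` with the limit `∫ r²η₀`.

The printed proof works with the `ω_θ`-equation (4.1) on the half-plane `Ω` and weight cut-offs;
the route above is the classical conservation of the impulse `½∫ x × ω` (e.g. Majda–Bertozzi 2002,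
§1.7, Prop. 1.12) localised with `χ_R`, which needs no decay of the vorticity.

## Main result

* `GallaySverak2015.ImpulseConservation_holds : GallaySverak2015.ImpulseConservation`.

## Mathlib / tree search

`lean search 'ImpulseConservation_holds'`: none (2026-08-26). Used from the tree: `cutoff`,
`tsupport_cutoff_subset`, `tendsto_integral_cutoff_mul`, `laplacian_comp_smul`
(`WholeSpaceIBP`, `MildSolutionProofs`); `curl_eq_curlCLM`, `contDiff_curl`,
`hasCompactSupport_curl`, `curl_eq_zero_of_notMem_tsupport`,
`integral_inner_curl_eq_integral_inner_curl` (`TaoEnstrophyLocalisation`, `VorticityCalculus`);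
`divergence_curl_eq_zero_holds` (`VectorCalculusProofs`);
`IsClassicalNSSolutionOn.integral_inner_sub_eq_pressure` (`ClassicalNSPairingIdentity`);
`rotGen`, `rotGenL`, `inner_rotGen_self_eq`, `cylRadius_sq`, `curl_eq_hadamardQuotFst_smul_rotGen`,
`angVortQuot_eq_hadamardQuotFst_curl`, `contDiff_angVortQuot`, `continuous_cylRadius`;
`IsTaoSolutionOn.isAxisymmetric`, `.hasNoSwirl`, `.angVortQuot_nonneg_of_datum`,
`.integrable_norm_sq`, `lintegral_enorm_sq_eq_lintegral_iteratedFDeriv_zero`. Mathlib: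
`fderiv_comp_smul`, `Measure.addHaar_closedBall`, `lintegral_liminf_le` (Fatou),
`ofReal_integral_eq_lintegral_ofReal`, `hasFiniteIntegral_iff_ofReal`, `tendsto_nhds_unique`.

## References

* Th. Gallay, V. Šverák, *Remarks on the Cauchy problem for the axisymmetric Navier–Stokes
  equations*, Confluentes Math. 7 (2015) 67–92 = arXiv:1510.01036: Lemma 6.4 (arXiv p. 19),
  (1.9) (p. 3). [GallaySverak2016]
* A. J. Majda, A. L. Bertozzi, *Vorticity and Incompressible Flow*, CUP 2002, §1.7
  (conserved quantities: the impulse `½∫ x × ω`). [MajdaBertozziCUP2002]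
-/

noncomputable section

open MeasureTheory Set Function Filter Topology InnerProductSpace Metric
open scoped RealInnerProductSpace ENNReal NNReal Laplacian ContDiff Interval

namespace Literature.Analysis.FluidPDE

/-! ### The impulse test fields `curl (χ_R J)` -/

section TestField

/-- The vector potential `x ↦ χ_R(x) · Jx` (`Jx = (-x₁, x₀, 0)`) is smooth. [folklore] -/
private theorem contDiff_cutoff_smul_rotGen {n : ℕ∞} (R : ℝ) :
    ContDiff ℝ n (fun x : EuclideanSpace ℝ (Fin 3) => cutoff R x • rotGen x) :=
  (contDiff_cutoff R).smul rotGenL.contDiff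

/-- The vector potential `χ_R J` has compact support (`R > 0`). [folklore] -/
private theorem hasCompactSupport_cutoff_smul_rotGen {R : ℝ} (hR : 0 < R) :
    HasCompactSupport (fun x : EuclideanSpace ℝ (Fin 3) => cutoff R x • rotGen x) :=
  (hasCompactSupport_cutoff hR).smul_right

/-- The vector potential `χ_R J` is supported in the closed ball of radius `2R`. [folklore] -/
private theorem tsupport_cutoff_smul_rotGen_subset {R : ℝ} (hR : 0 < R) :
    tsupport (fun x : EuclideanSpace ℝ (Fin 3) => cutoff R x • rotGen x) ⊆ closedBall 0 (2 * R) :=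
  (tsupport_smul_subset_left _ _).trans (tsupport_cutoff_subset hR)

/-- Scaling of the potential: `χ_R(x) Jx = R · (χ_1 J)(x / R)`. [folklore] -/
private theorem cutoff_smul_rotGen_eq_scale {R : ℝ} (hR : 0 < R) :
    (fun x : EuclideanSpace ℝ (Fin 3) => cutoff R x • rotGen x) =
      fun x => R • (fun y : EuclideanSpace ℝ (Fin 3) => cutoff 1 y • rotGen y) (R⁻¹ • x) := by
  funext x
  have h1 : cutoff 1 (R⁻¹ • x) = cutoff R x := by simp [cutoff_apply]
  simp only [h1, rotGen_smul, smul_smul]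
  congr 1
  field_simp

/-- Scaling of the Jacobian of the potential: `D(χ_R J)(x) = D(χ_1 J)(x / R)`. [folklore] -/
private theorem fderiv_cutoff_smul_rotGen_eq {R : ℝ} (hR : 0 < R) (x : EuclideanSpace ℝ (Fin 3)) :
    fderiv ℝ (fun x : EuclideanSpace ℝ (Fin 3) => cutoff R x • rotGen x) x =
      fderiv ℝ (fun y : EuclideanSpace ℝ (Fin 3) => cutoff 1 y • rotGen y) (R⁻¹ • x) := by
  rw [cutoff_smul_rotGen_eq_scale hR]
  have hd : DifferentiableAt ℝ
      (fun x => (fun y : EuclideanSpace ℝ (Fin 3) => cutoff 1 y • rotGen y) (R⁻¹ • x)) x :=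
    (((contDiff_cutoff_smul_rotGen (n := 1) 1).differentiable one_ne_zero).comp
      (differentiable_id.const_smul R⁻¹)).differentiableAt
  rw [fderiv_fun_const_smul hd,
    fderiv_comp_smul (f := fun y : EuclideanSpace ℝ (Fin 3) => cutoff 1 y • rotGen y) R⁻¹, smul_smul,
    mul_inv_cancel₀ hR.ne', one_smul]

/-- **Scaling of the test field**: `curl (χ_R J)(x) = curl (χ_1 J)(x / R)`. [folklore] -/
private theorem curl_cutoff_smul_rotGen_eq {R : ℝ} (hR : 0 < R) (x : EuclideanSpace ℝ (Fin 3)) :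
    curl (fun x : EuclideanSpace ℝ (Fin 3) => cutoff R x • rotGen x) x =
      curl (fun y : EuclideanSpace ℝ (Fin 3) => cutoff 1 y • rotGen y) (R⁻¹ • x) := by
  rw [curl_eq_curlCLM, curl_eq_curlCLM, fderiv_cutoff_smul_rotGen_eq hR]

/-- The test field `curl (χ_R J)` is smooth. [folklore] -/
private theorem contDiff_curl_cutoff_smul_rotGen (n : ℕ) (R : ℝ) :
    ContDiff ℝ n (curl fun x : EuclideanSpace ℝ (Fin 3) => cutoff R x • rotGen x) :=
  contDiff_curl (n := n) (by exact_mod_cast contDiff_cutoff_smul_rotGen (n := (n + 1 : ℕ)) R)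

/-- The test field `curl (χ_R J)` has compact support (`R > 0`). [folklore] -/
private theorem hasCompactSupport_curl_cutoff_smul_rotGen {R : ℝ} (hR : 0 < R) :
    HasCompactSupport (curl fun x : EuclideanSpace ℝ (Fin 3) => cutoff R x • rotGen x) :=
  hasCompactSupport_curl (hasCompactSupport_cutoff_smul_rotGen hR)

/-- The test field `curl (χ_R J)` is supported in the closed ball of radius `2R`. [folklore] -/
private theorem tsupport_curl_cutoff_smul_rotGen_subset {R : ℝ} (hR : 0 < R) :
    tsupport (curl fun x : EuclideanSpace ℝ (Fin 3) => cutoff R x • rotGen x) ⊆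
      closedBall 0 (2 * R) := by
  refine (closure_minimal (fun x hx => ?_) (isClosed_tsupport _)).trans
    (tsupport_cutoff_smul_rotGen_subset hR)
  by_contra hx'
  exact hx (curl_eq_zero_of_notMem_tsupport hx')

/-- The test field `curl (χ_R J)` is divergence free (`div curl = 0`). [folklore] -/
private theorem divergence_curl_cutoff_smul_rotGen (R : ℝ) (x : EuclideanSpace ℝ (Fin 3)) :
    VectorCalculus.divergence (curl fun x : EuclideanSpace ℝ (Fin 3) => cutoff R x • rotGen x) x = 0 :=
  divergence_curl_eq_zero_holds _ (contDiff_cutoff_smul_rotGen (n := 2) R) x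

/-- **Uniform bounds for the scaled test fields**: there are `B₁, B₂ ≥ 0` with
`‖D(curl (χ_R J))(x)‖ ≤ B₁ / R` and `‖Δ(curl (χ_R J))(x)‖ ≤ B₂ / R²` for all `R > 0` and all `x`
(scaling from the fixed profile `curl (χ_1 J) ∈ C_c^∞`). [folklore] -/
private theorem exists_bounds_curl_cutoff_smul_rotGen :
    ∃ B₁ B₂ : ℝ, 0 ≤ B₁ ∧ 0 ≤ B₂ ∧ ∀ R : ℝ, 0 < R → ∀ x : EuclideanSpace ℝ (Fin 3),
      ‖fderiv ℝ (curl fun x : EuclideanSpace ℝ (Fin 3) => cutoff R x • rotGen x) x‖ ≤ B₁ / R ∧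
        ‖Δ (curl fun x : EuclideanSpace ℝ (Fin 3) => cutoff R x • rotGen x) x‖ ≤ B₂ / R ^ 2 := by
  set ψ₁ : EuclideanSpace ℝ (Fin 3) → EuclideanSpace ℝ (Fin 3) :=
    curl fun y : EuclideanSpace ℝ (Fin 3) => cutoff 1 y • rotGen y with hψ₁
  have hψ2 : ContDiff ℝ 2 ψ₁ := contDiff_curl_cutoff_smul_rotGen 2 1
  have hψ1 : ContDiff ℝ 1 ψ₁ := hψ2.of_le one_le_two
  have hψc : HasCompactSupport ψ₁ := hasCompactSupport_curl_cutoff_smul_rotGen one_pos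
  obtain ⟨B₁, hB₁⟩ := (hψ1.continuous_fderiv one_ne_zero).bounded_above_of_compact_support
    (hψc.fderiv (𝕜 := ℝ))
  have hΔc : HasCompactSupport (Δ ψ₁) :=
    HasCompactSupport.intro hψc fun x hx => laplacian_eq_zero_of_notMem_tsupport hx
  obtain ⟨B₂, hB₂⟩ := (continuous_laplacian hψ2).bounded_above_of_compact_support hΔc
  have hB₁0 : 0 ≤ B₁ := (norm_nonneg _).trans (hB₁ 0)
  have hB₂0 : 0 ≤ B₂ := (norm_nonneg _).trans (hB₂ 0)
  refine ⟨B₁, B₂, hB₁0, hB₂0, fun R hR x => ?_⟩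
  have hfun : (curl fun x : EuclideanSpace ℝ (Fin 3) => cutoff R x • rotGen x) =
      fun x => ψ₁ (R⁻¹ • x) := funext fun x => curl_cutoff_smul_rotGen_eq hR x
  have hRinv : 0 ≤ R⁻¹ := inv_nonneg.2 hR.le
  rw [hfun]
  constructor
  · rw [fderiv_comp_smul R⁻¹, norm_smul, Real.norm_of_nonneg hRinv, div_eq_inv_mul]
    exact mul_le_mul_of_nonneg_left (hB₁ _) hRinv
  · rw [laplacian_comp_smul hψ2 R⁻¹ x, norm_smul, norm_pow, Real.norm_of_nonneg hRinv, inv_pow,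
      div_eq_inv_mul]
    exact mul_le_mul_of_nonneg_left (hB₂ _) (by positivity)

end TestField

/-! ### The truncated impulse as a pairing of the velocity with the test field -/

section Pairing

/-- **Moving the curl onto the weight**: `∫ χ_R ⟪curl v, J⟫ = ∫ ⟪v, curl (χ_R J)⟫` for `v ∈ C¹`
(the tree's integration by parts for the curl, `integral_inner_curl_eq_integral_inner_curl`).
[folklore] -/
private theorem integral_cutoff_mul_inner_curl_rotGen
    {v : EuclideanSpace ℝ (Fin 3) → EuclideanSpace ℝ (Fin 3)} (hv : ContDiff ℝ 1 v)
    {R : ℝ} (hR : 0 < R) :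
    ∫ x, cutoff R x * ⟪curl v x, rotGen x⟫ =
      ∫ x, ⟪v x, curl (fun y : EuclideanSpace ℝ (Fin 3) => cutoff R y • rotGen y) x⟫ := by
  rw [← integral_inner_curl_eq_integral_inner_curl hv (contDiff_cutoff_smul_rotGen (n := 1) R)
    (hasCompactSupport_cutoff_smul_rotGen hR)]
  exact integral_congr_ae (Eventually.of_forall fun x => by
    simp only [real_inner_smul_right])

/-- **The vorticity moment is the impulse density**: for an axisymmetric swirl-free `v ∈ C³`,
`⟪curl v x, Jx⟫ = r(x)² · (ω_θ/r)(x)` (`curl v = (ω_θ/r) J`, `|J x|² = r²`).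
[cite: GallaySverak2016, §1 (1.3) and (1.9) (arXiv pp. 2–3)] -/
private theorem inner_curl_rotGen_eq_cylRadius_sq_mul_angVortQuot
    {v : EuclideanSpace ℝ (Fin 3) → EuclideanSpace ℝ (Fin 3)} (hax : IsAxisymmetric v)
    (hsw : HasNoSwirl v) (hv : ContDiff ℝ 3 v) (x : EuclideanSpace ℝ (Fin 3)) :
    ⟪curl v x, rotGen x⟫ = cylRadius x ^ 2 * angVortQuot v x := by
  have hv2 : ContDiff ℝ 2 v := hv.of_le (by norm_num)
  rw [curl_eq_hadamardQuotFst_smul_rotGen hax hsw hv2 x,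
    ← angVortQuot_eq_hadamardQuotFst_curl hax hsw hv, real_inner_smul_left, inner_rotGen_self_eq,
    cylRadius_sq, mul_comm]

/-- **The truncated impulse of a smooth axisymmetric swirl-free field as a velocity pairing**:
`∫ χ_R r² (ω_θ/r) dx = ∫ ⟪v, curl (χ_R J)⟫`. [folklore] -/
private theorem integral_cutoff_mul_impulse_eq_inner
    {v : EuclideanSpace ℝ (Fin 3) → EuclideanSpace ℝ (Fin 3)} (hax : IsAxisymmetric v)
    (hsw : HasNoSwirl v) (hv : ContDiff ℝ 3 v) {R : ℝ} (hR : 0 < R) :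
    ∫ x, cutoff R x * (cylRadius x ^ 2 * angVortQuot v x) =
      ∫ x, ⟪v x, curl (fun y : EuclideanSpace ℝ (Fin 3) => cutoff R y • rotGen y) x⟫ := by
  rw [← integral_cutoff_mul_inner_curl_rotGen (hv.of_le (by norm_num)) hR]
  exact integral_congr_ae (Eventually.of_forall fun x => by
    simp only [inner_curl_rotGen_eq_cylRadius_sq_mul_angVortQuot hax hsw hv x])

end Pairing

/-! ### The transport and viscous pairings against `curl (χ_R J)` are `O(R^{-1/2})` -/

section SliceBound

/-- **The slice estimate.** For every `ν` and every energy level `E` there is `K` such that for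
all `R ≥ 1` and every continuous `v` with `∫ ‖v‖² ≤ E`:
`|∫ (⟪v, (v·∇)ψ_R⟫ + ν ⟪v, Δψ_R⟫)| ≤ K / √R`, `ψ_R = curl (χ_R J)` — since `‖Dψ_R‖ ≤ B₁/R`,
`‖Δψ_R‖ ≤ B₂/R²` on the ball of radius `2R` (volume `8R³|B₁|`) and zero outside, and
`‖v‖ 𝟙_B ≤ (λ𝟙_B + λ⁻¹‖v‖²)/2` with `λ = (R√R)⁻¹`. Only the energy of `v` enters. [folklore] -/
private theorem exists_pairing_bound (ν E : ℝ) :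
    ∃ K : ℝ, ∀ R : ℝ, 1 ≤ R →
      ∀ v : EuclideanSpace ℝ (Fin 3) → EuclideanSpace ℝ (Fin 3), Continuous v →
        Integrable (fun x => ‖v x‖ ^ 2) → ∫ x, ‖v x‖ ^ 2 ≤ E →
        |∫ x, (⟪v x, convect v (curl fun y : EuclideanSpace ℝ (Fin 3) => cutoff R y • rotGen y) x⟫ +
            ν * ⟪v x, Δ (curl fun y : EuclideanSpace ℝ (Fin 3) => cutoff R y • rotGen y) x⟫)| ≤
          K / Real.sqrt R := by
  obtain ⟨B₁, B₂, hB₁, hB₂, hB⟩ := exists_bounds_curl_cutoff_smul_rotGen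
  set c₁ : ℝ := (volume (ball (0 : EuclideanSpace ℝ (Fin 3)) 1)).toReal with hc₁
  have hc₁0 : 0 ≤ c₁ := ENNReal.toReal_nonneg
  refine ⟨B₁ * max E 0 + |ν| * B₂ * (8 * c₁ + max E 0) / 2, fun R hR v hvc hv2 hvE => ?_⟩
  have hR0 : 0 < R := one_pos.trans_le hR
  have hE0 : 0 ≤ E := (integral_nonneg fun x => sq_nonneg _).trans hvE
  rw [max_eq_left hE0]
  set ψ : EuclideanSpace ℝ (Fin 3) → EuclideanSpace ℝ (Fin 3) :=
    curl fun y : EuclideanSpace ℝ (Fin 3) => cutoff R y • rotGen y with hψ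
  set S : Set (EuclideanSpace ℝ (Fin 3)) := closedBall 0 (2 * R) with hS
  set s : ℝ := Real.sqrt R with hs
  have hs0 : 0 < s := Real.sqrt_pos.2 hR0
  have hss : s * s = R := Real.mul_self_sqrt hR0.le
  have hs1 : 1 ≤ s := by rw [hs, ← Real.sqrt_one]; exact Real.sqrt_le_sqrt hR
  set lam : ℝ := (R * s)⁻¹ with hlam
  have hlam0 : 0 < lam := inv_pos.2 (mul_pos hR0 hs0)
  -- the pointwise majorant
  set g : EuclideanSpace ℝ (Fin 3) → ℝ := fun x =>
    B₁ / R * ‖v x‖ ^ 2 +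
      |ν| * (B₂ / R ^ 2) * ((lam * S.indicator (fun _ => (1 : ℝ)) x + lam⁻¹ * ‖v x‖ ^ 2) / 2)
    with hg
  have hνB : 0 ≤ |ν| * (B₂ / R ^ 2) := by positivity
  have hbound : ∀ x, ‖⟪v x, convect v ψ x⟫ + ν * ⟪v x, Δ ψ x⟫‖ ≤ g x := by
    intro x
    obtain ⟨hD, hL⟩ := hB R hR0 x
    have h1 : |⟪v x, convect v ψ x⟫| ≤ B₁ / R * ‖v x‖ ^ 2 := by
      calc |⟪v x, convect v ψ x⟫| ≤ ‖v x‖ * ‖convect v ψ x‖ := abs_real_inner_le_norm _ _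
        _ ≤ ‖v x‖ * (‖fderiv ℝ ψ x‖ * ‖v x‖) :=
            mul_le_mul_of_nonneg_left (ContinuousLinearMap.le_opNorm _ _) (norm_nonneg _)
        _ ≤ ‖v x‖ * (B₁ / R * ‖v x‖) := by gcongr
        _ = B₁ / R * ‖v x‖ ^ 2 := by ring
    have h2 : |ν * ⟪v x, Δ ψ x⟫| ≤
        |ν| * (B₂ / R ^ 2) * (‖v x‖ * S.indicator (fun _ => (1 : ℝ)) x) := by
      rw [abs_mul]
      by_cases hx : x ∈ S
      · rw [indicator_of_mem hx, mul_one]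
        calc |ν| * |⟪v x, Δ ψ x⟫| ≤ |ν| * (‖v x‖ * ‖Δ ψ x‖) :=
              mul_le_mul_of_nonneg_left (abs_real_inner_le_norm _ _) (abs_nonneg _)
          _ ≤ |ν| * (‖v x‖ * (B₂ / R ^ 2)) := by gcongr
          _ = |ν| * (B₂ / R ^ 2) * ‖v x‖ := by ring
      · have hΔ0 : Δ ψ x = 0 :=
          laplacian_eq_zero_of_notMem_tsupport fun h =>
            hx (tsupport_curl_cutoff_smul_rotGen_subset hR0 h)
        rw [hΔ0, inner_zero_right, abs_zero, mul_zero, indicator_of_notMem hx, mul_zero, mul_zero]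
    have h3 : ‖v x‖ * S.indicator (fun _ => (1 : ℝ)) x ≤
        (lam * S.indicator (fun _ => (1 : ℝ)) x + lam⁻¹ * ‖v x‖ ^ 2) / 2 := by
      by_cases hx : x ∈ S
      · rw [indicator_of_mem hx, mul_one, mul_one, le_div_iff₀ two_pos]
        have key : ‖v x‖ * 2 * lam ≤ (lam + lam⁻¹ * ‖v x‖ ^ 2) * lam := by
          have e : (lam + lam⁻¹ * ‖v x‖ ^ 2) * lam = lam ^ 2 + ‖v x‖ ^ 2 := by
            rw [add_mul, ← pow_two, mul_comm (lam⁻¹ * _) lam, ← mul_assoc, mul_inv_cancel₀ hlam0.ne',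
              one_mul]
          rw [e]
          nlinarith [sq_nonneg (lam - ‖v x‖)]
        exact le_of_mul_le_mul_right key hlam0
      · rw [indicator_of_notMem hx, mul_zero, mul_zero, zero_add]
        positivity
    calc ‖⟪v x, convect v ψ x⟫ + ν * ⟪v x, Δ ψ x⟫‖
        = |⟪v x, convect v ψ x⟫ + ν * ⟪v x, Δ ψ x⟫| := Real.norm_eq_abs _
      _ ≤ |⟪v x, convect v ψ x⟫| + |ν * ⟪v x, Δ ψ x⟫| := abs_add_le _ _
      _ ≤ B₁ / R * ‖v x‖ ^ 2 + |ν| * (B₂ / R ^ 2) * (‖v x‖ * S.indicator (fun _ => (1 : ℝ)) x) :=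
          add_le_add h1 h2
      _ ≤ g x := by
          simp only [hg]
          exact add_le_add le_rfl (mul_le_mul_of_nonneg_left h3 hνB)
  -- integrability of the majorant and its integral
  have hind : Integrable (S.indicator fun _ => (1 : ℝ)) :=
    (integrable_indicator_iff measurableSet_closedBall).2
      (integrableOn_const measure_closedBall_lt_top.ne)
  have i1 : Integrable (fun x => B₁ / R * ‖v x‖ ^ 2) := hv2.const_mul _
  have i2 : Integrable (fun x => lam * S.indicator (fun _ => (1 : ℝ)) x) := hind.const_mul _
  have i3 : Integrable (fun x => lam⁻¹ * ‖v x‖ ^ 2) := hv2.const_mul _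
  have i4 : Integrable (fun x =>
      (lam * S.indicator (fun _ => (1 : ℝ)) x + lam⁻¹ * ‖v x‖ ^ 2) / 2) := (i2.add i3).div_const 2
  have i5 : Integrable (fun x =>
      |ν| * (B₂ / R ^ 2) * ((lam * S.indicator (fun _ => (1 : ℝ)) x + lam⁻¹ * ‖v x‖ ^ 2) / 2)) :=
    i4.const_mul _
  have hgi : Integrable g := by
    rw [hg]
    exact i1.add i5
  have hvol : volume.real (closedBall (0 : EuclideanSpace ℝ (Fin 3)) (2 * R)) = (2 * R) ^ 3 * c₁ := by
    rw [measureReal_def, Measure.addHaar_closedBall _ _ (by positivity), ENNReal.toReal_mul,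
      finrank_euclideanSpace_fin, ENNReal.toReal_ofReal (by positivity)]
  have hIg : ∫ x, g x =
      B₁ / R * (∫ x, ‖v x‖ ^ 2) +
        |ν| * (B₂ / R ^ 2) * ((lam * ((2 * R) ^ 3 * c₁) + lam⁻¹ * ∫ x, ‖v x‖ ^ 2) / 2) := by
    simp only [hg]
    rw [integral_add i1 i5, integral_const_mul, integral_const_mul, integral_div,
      integral_add i2 i3, integral_const_mul, integral_const_mul,
      integral_indicator_const _ measurableSet_closedBall, hvol, smul_eq_mul, mul_one]
  -- assemble
  calc |∫ x, (⟪v x, convect v ψ x⟫ + ν * ⟪v x, Δ ψ x⟫)|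
      = ‖∫ x, (⟪v x, convect v ψ x⟫ + ν * ⟪v x, Δ ψ x⟫)‖ := (Real.norm_eq_abs _).symm
    _ ≤ ∫ x, g x := norm_integral_le_of_norm_le hgi (Eventually.of_forall hbound)
    _ = B₁ / R * (∫ x, ‖v x‖ ^ 2) +
        |ν| * (B₂ / R ^ 2) * ((lam * ((2 * R) ^ 3 * c₁) + lam⁻¹ * ∫ x, ‖v x‖ ^ 2) / 2) := hIg
    _ ≤ B₁ / R * E + |ν| * (B₂ / R ^ 2) * ((lam * ((2 * R) ^ 3 * c₁) + lam⁻¹ * E) / 2) := by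
        gcongr
    _ = B₁ * E / (s * s) + |ν| * B₂ * (8 * c₁ + E) / 2 / s := by
        rw [hlam, ← hss]
        field_simp
        ring
    _ ≤ B₁ * E / s + |ν| * B₂ * (8 * c₁ + E) / 2 / s := by
        gcongr ?_ + _
        exact div_le_div_of_nonneg_left (by positivity) hs0
          (le_mul_of_one_le_left hs0.le hs1)
    _ = (B₁ * E + |ν| * B₂ * (8 * c₁ + E) / 2) / s := by ring

end SliceBound

/-! ### Along a Tao-class solution the truncated impulse is conserved up to `O(R^{-1/2})` -/

section Dynamics

variable {T ν : ℝ} {u₀ : EuclideanSpace ℝ (Fin 3) → EuclideanSpace ℝ (Fin 3)}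
  {u : ℝ → EuclideanSpace ℝ (Fin 3) → EuclideanSpace ℝ (Fin 3)}
  {p : ℝ → EuclideanSpace ℝ (Fin 3) → ℝ}

/-- A uniform energy level along a Tao-class solution: `∫ ‖u(t)‖² ≤ E` for all `t ∈ [0, T]`
(the `H⁰` conjunct of `HasBoundedSobolevNormsOn`). [folklore] -/
private theorem IsTaoSolutionOn.exists_integral_norm_sq_le (h : IsTaoSolutionOn T ν u₀ u p) :
    ∃ E : ℝ, ∀ t ∈ Icc 0 T, ∫ x, ‖u t x‖ ^ 2 ≤ E := by
  obtain ⟨C, hC⟩ := h.sobolev 0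
  refine ⟨(C : ℝ), fun t ht => ?_⟩
  have h1 : ∫⁻ x, ‖u t x‖ₑ ^ 2 ≤ C := by
    rw [lintegral_enorm_sq_eq_lintegral_iteratedFDeriv_zero]
    exact hC t ht
  have h2 : ∫ x, ‖u t x‖ ^ 2 = (∫⁻ x, ‖u t x‖ₑ ^ 2).toReal := by
    rw [integral_eq_lintegral_of_nonneg_ae (Eventually.of_forall fun x => sq_nonneg _)
      (h.integrable_norm_sq ht).aestronglyMeasurable]
    congr 1
    refine lintegral_congr fun x => ?_
    rw [ENNReal.ofReal_pow (norm_nonneg _), ofReal_norm]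
  rw [h2]
  have h3 : (∫⁻ x, ‖u t x‖ₑ ^ 2).toReal ≤ ((C : ℝ≥0∞)).toReal :=
    ENNReal.toReal_mono ENNReal.coe_ne_top h1
  simpa using h3

/-- **Near-conservation of the truncated impulse.** Along a Tao-class solution on `[0, T]`
(`0 < T`) there is `K` with
`|∫ ⟪u(t), curl (χ_R J)⟫ - ∫ ⟪u(0), curl (χ_R J)⟫| ≤ K / √R` for all `R ≥ 1`, `t ∈ [0, T]`:
the classical momentum equation tested against the divergence-free compactly supported field
`curl (χ_R J)` (`IsClassicalNSSolutionOn.integral_inner_sub_eq_pressure`; the pressure term drops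
since `div curl = 0`, the force is `0`) leaves `∫₀ᵗ ∫ (⟪u, (u·∇)ψ_R⟫ + ν⟪u, Δψ_R⟫)`, which is
`≤ t K₀/√R` by the slice estimate and the uniform energy level. [folklore] -/
private theorem IsTaoSolutionOn.exists_abs_pairing_sub_le (h : IsTaoSolutionOn T ν u₀ u p)
    (hT : 0 < T) :
    ∃ K : ℝ, ∀ R : ℝ, 1 ≤ R → ∀ t ∈ Icc 0 T,
      |(∫ x, ⟪u t x, curl (fun y : EuclideanSpace ℝ (Fin 3) => cutoff R y • rotGen y) x⟫) -
          ∫ x, ⟪u 0 x, curl (fun y : EuclideanSpace ℝ (Fin 3) => cutoff R y • rotGen y) x⟫| ≤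
        K / Real.sqrt R := by
  obtain ⟨E, hE⟩ := h.exists_integral_norm_sq_le
  obtain ⟨K, hK⟩ := exists_pairing_bound ν E
  refine ⟨T * max K 0, fun R hR t ht => ?_⟩
  have hR0 : 0 < R := one_pos.trans_le hR
  set ψ : EuclideanSpace ℝ (Fin 3) → EuclideanSpace ℝ (Fin 3) :=
    curl fun y : EuclideanSpace ℝ (Fin 3) => cutoff R y • rotGen y with hψ
  have hψ2 : ContDiff ℝ 2 ψ := contDiff_curl_cutoff_smul_rotGen 2 R
  have hψc : HasCompactSupport ψ := hasCompactSupport_curl_cutoff_smul_rotGen hR0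
  rw [h.classical.integral_inner_sub_eq_pressure hT hψ2 hψc le_rfl ht.1 ht.2]
  have hKR : 0 ≤ max K 0 / Real.sqrt R := div_nonneg (le_max_right _ _) (Real.sqrt_nonneg _)
  have hτ : ∀ τ ∈ Ι (0 : ℝ) t,
      ‖(∫ x, (⟪u τ x, convect (u τ) ψ x⟫ + ν * ⟪u τ x, Δ ψ x⟫ +
          ⟪(0 : ℝ → EuclideanSpace ℝ (Fin 3) → EuclideanSpace ℝ (Fin 3)) τ x, ψ x⟫)) +
        ∫ x, p τ x * VectorCalculus.divergence ψ x‖ ≤ max K 0 / Real.sqrt R := by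
    intro τ hτ
    rw [uIoc_of_le ht.1] at hτ
    have hτT : τ ∈ Icc 0 T := ⟨hτ.1.le, hτ.2.trans ht.2⟩
    have hdiv : (fun x => p τ x * VectorCalculus.divergence ψ x) = fun _ => 0 := by
      funext x
      rw [hψ, divergence_curl_cutoff_smul_rotGen, mul_zero]
    have hf0 : (fun x => ⟪u τ x, convect (u τ) ψ x⟫ + ν * ⟪u τ x, Δ ψ x⟫ +
        ⟪(0 : ℝ → EuclideanSpace ℝ (Fin 3) → EuclideanSpace ℝ (Fin 3)) τ x, ψ x⟫) =
        fun x => ⟪u τ x, convect (u τ) ψ x⟫ + ν * ⟪u τ x, Δ ψ x⟫ := by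
      funext x
      simp
    rw [hdiv, integral_zero, add_zero, hf0, Real.norm_eq_abs]
    exact (hK R hR (u τ) (h.classical.contDiff_velocity hτT).continuous (h.integrable_norm_sq hτT)
      (hE τ hτT)).trans (div_le_div_of_nonneg_right (le_max_left _ _) (Real.sqrt_nonneg _))
  calc |∫ τ in (0 : ℝ)..t, ((∫ x, (⟪u τ x, convect (u τ) ψ x⟫ + ν * ⟪u τ x, Δ ψ x⟫ +
            ⟪(0 : ℝ → EuclideanSpace ℝ (Fin 3) → EuclideanSpace ℝ (Fin 3)) τ x, ψ x⟫)) +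
          ∫ x, p τ x * VectorCalculus.divergence ψ x)|
      = ‖∫ τ in (0 : ℝ)..t, ((∫ x, (⟪u τ x, convect (u τ) ψ x⟫ + ν * ⟪u τ x, Δ ψ x⟫ +
            ⟪(0 : ℝ → EuclideanSpace ℝ (Fin 3) → EuclideanSpace ℝ (Fin 3)) τ x, ψ x⟫)) +
          ∫ x, p τ x * VectorCalculus.divergence ψ x)‖ := (Real.norm_eq_abs _).symm
    _ ≤ max K 0 / Real.sqrt R * |t - 0| := intervalIntegral.norm_integral_le_of_norm_le_const hτ
    _ ≤ max K 0 / Real.sqrt R * T := by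
        rw [sub_zero, abs_of_nonneg ht.1]
        exact mul_le_mul_of_nonneg_left ht.2 hKR
    _ = T * max K 0 / Real.sqrt R := by ring

end Dynamics

/-! ### Gallay–Šverák 2015, Lemma 6.4: the discharge -/

/-- **Gallay–Šverák 2015, Lemma 6.4 (conservation of the impulse) is a theorem** — discharge of
the named fact `GallaySverak2015.ImpulseConservation` (`AxisymNoSwirlScaleInvariantBounds.lean`):
along a Tao-class solution (`ν = 1`) on `[0, T]` from an axisymmetric swirl-free datum with
`η₀ = ω_θ/r ≥ 0`, `η₀ ∈ L¹`, `r²η₀ ∈ L¹`, for every `t ∈ [0, T]` the weighted slice `r²η(t)` is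
integrable and `∫ r²η(t) dx = ∫ r²η₀ dx`. Proof (3-D impulse route): with
`ψ_R = curl (χ_R J)`, `∫ χ_R r²η(t) = ∫ ⟪u(t), ψ_R⟫` differs from its value at `t = 0` by at most
`K/√R`; at `t = 0` it tends to `∫ r²η₀` (dominated convergence); `η(t) ≥ 0` (maximum principle,
`IsTaoSolutionOn.angVortQuot_nonneg_of_datum`), so Fatou's lemma gives `r²η(t) ∈ L¹` with
`∫ r²η(t) ≤ ∫ r²η₀`, and dominated convergence then identifies `∫ r²η(t)` with the limit
`∫ r²η₀`. The printed proof works instead with the `ω_θ`-equation (4.1) on the half-plane;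
only the energy `sup_t ‖u(t)‖_{L²}` of the solution is used here.
[cite: GallaySverak2016, Lemma 6.4 (arXiv p. 19)] -/
theorem GallaySverak2015.ImpulseConservation_holds : GallaySverak2015.ImpulseConservation := by
  intro T u₀ u p hT h h0 h0' hη0 hL1 hImp t ht
  have h0T : (0 : ℝ) ∈ Icc 0 T := ⟨le_rfl, hT.le⟩
  have hax : ∀ s ∈ Icc 0 T, IsAxisymmetric (u s) := h.isAxisymmetric one_pos hT h0
  have hsw : ∀ s ∈ Icc 0 T, HasNoSwirl (u s) := h.hasNoSwirl one_pos hT h0 h0'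
  have hu3 : ∀ s ∈ Icc 0 T, ContDiff ℝ 3 (u s) := fun s hs =>
    (h.classical.contDiff_velocity hs).of_le (by norm_cast)
  -- the impulse densities `F s = r² η(s)`
  set F : ℝ → EuclideanSpace ℝ (Fin 3) → ℝ := fun s x => cylRadius x ^ 2 * angVortQuot (u s) x
    with hF
  have hFc : ∀ s ∈ Icc 0 T, Continuous (F s) := fun s hs =>
    (continuous_cylRadius.pow 2).mul
      (contDiff_angVortQuot (n := 0) (by exact_mod_cast hu3 s hs)).continuous
  have hF0 : F 0 = fun x => cylRadius x ^ 2 * angVortQuot u₀ x := by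
    funext x
    simp only [hF, h.initial]
  -- the truncated impulses are velocity pairings
  have hpair : ∀ s ∈ Icc 0 T, ∀ R : ℝ, 0 < R →
      ∫ x, cutoff R x * F s x =
        ∫ x, ⟪u s x, curl (fun y : EuclideanSpace ℝ (Fin 3) => cutoff R y • rotGen y) x⟫ :=
    fun s hs R hR => integral_cutoff_mul_impulse_eq_inner (hax s hs) (hsw s hs) (hu3 s hs) hR
  -- (a) at `t = 0` the truncated impulses converge to the impulse of the datum
  set I₀ : ℝ := ∫ x, cylRadius x ^ 2 * angVortQuot u₀ x with hI₀
  have hlim0 : Tendsto (fun n : ℕ => ∫ x, cutoff ((n : ℝ) + 1) x * F 0 x) atTop (𝓝 I₀) := by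
    rw [hF0]
    exact tendsto_integral_cutoff_mul hImp
  -- (b) near-conservation
  obtain ⟨K, hK⟩ := h.exists_abs_pairing_sub_le hT
  have hlim1 : Tendsto (fun n : ℕ =>
      (∫ x, cutoff ((n : ℝ) + 1) x * F t x) - ∫ x, cutoff ((n : ℝ) + 1) x * F 0 x) atTop (𝓝 0) := by
    have hrate : Tendsto (fun n : ℕ => K / Real.sqrt ((n : ℝ) + 1)) atTop (𝓝 0) := by
      have h1 : Tendsto (fun n : ℕ => Real.sqrt ((n : ℝ) + 1)) atTop atTop :=
        Real.tendsto_sqrt_atTop.comp (tendsto_natCast_atTop_atTop.atTop_add tendsto_const_nhds)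
      exact tendsto_const_nhds.div_atTop h1
    refine squeeze_zero_norm (fun n => ?_) hrate
    have hn1 : (1 : ℝ) ≤ (n : ℝ) + 1 := le_add_of_nonneg_left (Nat.cast_nonneg n)
    have hn0 : (0 : ℝ) < (n : ℝ) + 1 := by positivity
    rw [Real.norm_eq_abs, hpair t ht ((n : ℝ) + 1) hn0, hpair 0 h0T ((n : ℝ) + 1) hn0]
    exact hK _ hn1 t ht
  -- (c) hence the truncated impulses at time `t` converge to `I₀`
  have hlimt : Tendsto (fun n : ℕ => ∫ x, cutoff ((n : ℝ) + 1) x * F t x) atTop (𝓝 I₀) := by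
    have := hlim1.add hlim0
    rw [zero_add] at this
    exact this.congr fun n => sub_add_cancel _ _
  -- (d) `F t ≥ 0`, Fatou: `∫⁻ F t ≤ I₀`
  have hFt0 : ∀ x, 0 ≤ F t x := fun x =>
    mul_nonneg (sq_nonneg _) (h.angVortQuot_nonneg_of_datum hT one_pos h0 h0' hη0 ht x)
  have hint : ∀ n : ℕ, Integrable fun x => cutoff ((n : ℝ) + 1) x * F t x := fun n =>
    ((contDiff_cutoff (n := 0) _).continuous.mul (hFc t ht)).integrable_of_hasCompactSupport
      ((hasCompactSupport_cutoff (by positivity)).mul_right)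
  have hFatou : ∫⁻ x, ENNReal.ofReal (F t x) ≤ ENNReal.ofReal I₀ := by
    have hmeas : ∀ n : ℕ, Measurable fun x => ENNReal.ofReal (cutoff ((n : ℝ) + 1) x * F t x) :=
      fun n => ENNReal.measurable_ofReal.comp
        (((contDiff_cutoff (n := 0) _).continuous.mul (hFc t ht)).measurable)
    have hptw : ∀ x, Tendsto (fun n : ℕ => ENNReal.ofReal (cutoff ((n : ℝ) + 1) x * F t x)) atTop
        (𝓝 (ENNReal.ofReal (F t x))) := fun x =>
      ENNReal.tendsto_ofReal (by simpa using (tendsto_cutoff_natCast_add_one x).mul_const (F t x))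
    have hnn : ∀ n : ℕ, 0 ≤ᵐ[volume] fun x => cutoff ((n : ℝ) + 1) x * F t x := fun n =>
      Eventually.of_forall fun x => mul_nonneg (cutoff_nonneg _ _) (hFt0 x)
    calc ∫⁻ x, ENNReal.ofReal (F t x)
        = ∫⁻ x, liminf (fun n : ℕ => ENNReal.ofReal (cutoff ((n : ℝ) + 1) x * F t x)) atTop :=
          lintegral_congr fun x => ((hptw x).liminf_eq).symm
      _ ≤ liminf (fun n : ℕ => ∫⁻ x, ENNReal.ofReal (cutoff ((n : ℝ) + 1) x * F t x)) atTop :=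
          lintegral_liminf_le hmeas
      _ = liminf (fun n : ℕ => ENNReal.ofReal (∫ x, cutoff ((n : ℝ) + 1) x * F t x)) atTop := by
          refine liminf_congr (Eventually.of_forall fun n => ?_)
          rw [ofReal_integral_eq_lintegral_ofReal (hint n) (hnn n)]
      _ = ENNReal.ofReal I₀ := (ENNReal.tendsto_ofReal hlimt).liminf_eq
  -- (e) integrability of `r² η(t)` and (f) the value of its integral
  have hFint : Integrable (F t) := by
    refine ⟨(hFc t ht).aestronglyMeasurable, ?_⟩
    exact (hasFiniteIntegral_iff_ofReal (Eventually.of_forall hFt0)).2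
      (hFatou.trans_lt ENNReal.ofReal_lt_top)
  exact ⟨hFint, tendsto_nhds_unique (tendsto_integral_cutoff_mul hFint) hlimt⟩

end Literature.Analysis.FluidPDE

end
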